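import Mathlib
import Summits.ValiantsHypothesis.ValiantsHypothesis.Theorems.ValuativeGCTValuativeFlipPencilDensity
import Summits.ValiantsHypothesis.ValiantsHypothesis.Theorems.ValuativeGCTValuativeFlipFewLettersEquationFree
import Summits.ValiantsHypothesis.ValiantsHypothesis.Theorems.ValuativeGCTValuativeFlipQuaternaryPencilCertificates

/-!
# Quaternary quadrics and cubics are border-determinantal: `Det_2` has no equations at all, and
# `Det_3` is equation-free on four letters (row 4 of the few-row table at `m ≤ 3`)

Crux `ValuativeGCT.ValuativeFlip` (stmt-ValiantsHypothesis-12624), wall-breaker axis D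
("det-orbit-closure multiplicity bounds for detCensus", seat k3 gen 1 / 3), over the `k`-ary
pencil density criterion (`…PencilDensity`), the row-`k` bookkeeping (`…FewLettersEquationFree`)
and the two quaternary spanning certificates (`…QuaternaryPencilCertificates`).

The equation-free part of the few-letter table of `Det_m = Δ(det_m)` — the pairs `(k, m)` for
which EVERY `k`-ary form of degree `m` is border-determinantal, so that `K_m(λ*) = a_λ(δ[m])` for
all `λ` with `ℓ(λ) ≤ k` and no valuative flip lives on `≤ k`-row shapes at that `m` — is, by the
dimension count `k m² - (2m² - 2) ≥ C(m+k-1, k-1)`, contained in `{k ≤ 3} ∪ {k = 4, m ≤ 3}`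
(plus `m ≤ 1`).  Rows `k ≤ 3` are landed (binary forms; Dickson for ternary forms, two proofs).
This file supplies the two remaining cells by explicit SPANNING CERTIFICATES:

* `quaternaryCubic_mem_orbitClosure_detFormLex` — by the criterion at the cubic certificate
  (`quaternaryCubicPencil_certificate`: at `M = !![x₀, x₁, x₂; x₃, x₀, x₁; 0, x₂, x₃]` the `36`
  products `x_t · adj(M)_{ji}` span all `20` cubic monomials) **every quaternary cubic form lies in
  `Δ(det_3)`** — the density half of the classical theorem that the general cubic surface is
  determinantal (Grassmann 1855, Clebsch 1866; Dickson 1921; Beauville 2000 Cor. 6.4).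
* `quadric_mem_orbitClosure_detFormLex_two` — by the criterion at the quadric certificate
  (`!![x₀, x₁; x₂, x₃]`) **every quadratic form on `MatIdx 2` lies in `Δ(det_2)`**:
  `Δ(det_2) = Sym² ℂ⁴`, `orbitVanishingIdeal (detFormLex ℂ 2) 2 = ⊥`
  (`orbitVanishingIdeal_detFormLex_two_eq_bot`), `K_2(χ) = pleth(χ)` for every weight
  (`det_two_orbitMultiplicity_eq_plethysmCoeff`), and no valuative flip at `m = 2` at all
  (`noValuativeFlip_two`).
* Consequences at `m = 3`: `K_3(λ*) = a_λ(δ[3])` for `ℓ(λ) ≤ 4`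
  (`det_three_orbitMultiplicity_eq_plethysmCoeffOfPartition_of_card_parts_le_four`), `Det_3`
  majorises every orbit closure on four letters, no valuative flip on `≤ 4`-row shapes at `m = 3`
  for any `n ≤ 3` and any centre (`noValuativeFlip_three_of_card_parts_le_four`), and every flip
  witness at `m = 3` — in particular the bottom flip of the window at `(n, m) = (3, 3)` — has at
  least FIVE rows (`five_le_card_parts_of_valuativeFlip_three`).

With these two cells the equation-free region of the table is COMPLETE: for `k = 4, m ≥ 4` and for
`k ≥ 5, m ≥ 2` the restriction variety `res_k(Det_m)` is a proper subvariety of `Sym^m ℂ^k` by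
dimension, so `Det_m` has equations of some `≤ k`-row type there (the four-row count of line
`four-row-count` is the first such census).

References: L. E. Dickson, Trans. AMS 22 (1921) 167–179; A. Beauville, *Determinantal
hypersurfaces*, Michigan Math. J. 48 (2000) Cor. 6.4 (and, for the method — surjectivity of the
differential at one point — Adler's method, loc. cit., proof that general surfaces of degree `≤ 15` are
linear pfaffians); J. M. Landsberg, *Geometry and Complexity
Theory* (2017) §6.8 (Thm 6.8.2.1: determinantal quartic surfaces form a hypersurface); BLMW,
SIAM J. Comput. 40 (2011) §5.3.
-/

-- `Summit.ValiantsHypothesis.ValiantsHypothesis.…` is the tree's mandated single-conjunct layout (Sub = Summit).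
set_option linter.dupNamespace false

namespace Summit.ValiantsHypothesis.ValiantsHypothesis.Theorems.ValuativeFlip

open scoped BigOperators Matrix
open Finset
open MvPolynomial
open Literature.NumberTheory.DiophantineGeometry Literature.Computability.AlgebraicComplexity

noncomputable section

/-! ## The two quaternary pencils (file-local notation, as in `…QuaternaryPencilCertificates`) -/

/-- `A₄₃`: the coefficient tensor of the quaternary cubic pencil `!![x₀, x₁, x₂; x₃, x₀, x₁; 0, x₂, x₃]`. -/
local notation3 (prettyPrint := false) "A₄₃" => (fun v : Fin 4 × Fin 3 × Fin 3 =>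
  (![![(Pi.single 0 1 : Fin 4 → ℂ), Pi.single 1 1, Pi.single 2 1],
     ![Pi.single 3 1, Pi.single 0 1, Pi.single 1 1],
     ![0, Pi.single 2 1, Pi.single 3 1]] : Fin 3 → Fin 3 → Fin 4 → ℂ) v.2.1 v.2.2 v.1)

/-- `A₄₂`: the coefficient tensor of the quaternary quadric pencil `!![x₀, x₁; x₂, x₃]`. -/
local notation3 (prettyPrint := false) "A₄₂" => (fun v : Fin 4 × Fin 2 × Fin 2 =>
  (![![(Pi.single 0 1 : Fin 4 → ℂ), Pi.single 1 1], ![Pi.single 2 1, Pi.single 3 1]] :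
    Fin 2 → Fin 2 → Fin 4 → ℂ) v.2.1 v.2.2 v.1)

/-! ## Row 4 of the table at `m = 3`: every quaternary cubic is border-determinantal -/

section Cubics

/-- **Every quaternary cubic form lies in `Δ(det_3)`** (any four letters `a t` of the `3 × 3`
matrix): the pencil density criterion at the certificate `quaternaryCubicPencil_certificate`.
Classically: the general cubic surface is a linear determinant (Grassmann, Clebsch; Dickson 1921
§9; Beauville 2000 Cor. 6.4) — here its density half, with an elementary proof. [this crux] -/
theorem quaternaryCubic_mem_orbitClosure_detFormLex (a : Fin 4 → MatIdx 3)
    (q : MvPolynomial (MatIdx 3) ℂ) (hq : q.IsHomogeneous 3) (hvars : ↑q.vars ⊆ Set.range a) :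
    q ∈ orbitClosure (detFormLex ℂ 3) :=
  mem_orbitClosure_detFormLex_of_vars_subset_range_of_certificate A₄₃
    quaternaryCubicPencil_certificate a hq hvars

/-- **`Det_3` majorises every orbit closure on four letters**: for every cubic form `g` on
`MatIdx 3` and every weight `χ` of `GL_9` supported on at most four letters,
`mult_χ ℂ[Δ_3(g)] ≤ K_3(χ)`. [this crux] -/
theorem orbitMultiplicity_le_det_three_of_support_card_le_four {g : MvPolynomial (MatIdx 3) ℂ}
    (hg : g.IsHomogeneous 3) (S : Finset (MatIdx 3)) (hS : S.card ≤ 4)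
    (χ : Weight (MatIdx 3)) (hχ : ∀ i, i ∉ S → χ i = 0) :
    orbitMultiplicity ℂ g 3 χ ≤ orbitMultiplicity ℂ (detFormLex ℂ 3) 3 χ :=
  orbitMultiplicity_le_det_of_support_card_le_of_kForms quaternaryCubic_mem_orbitClosure_detFormLex
    hg S hS χ hχ

/-- **`Det_3` is equation-free on four letters: `K_3(χ) = pleth(χ)`** for every weight `χ` of
`GL_9` supported on at most four letters. [this crux] -/
theorem det_three_orbitMultiplicity_eq_plethysmCoeff_of_support_card_le_four
    (S : Finset (MatIdx 3)) (hS : S.card ≤ 4) (χ : Weight (MatIdx 3)) (hχ : ∀ i, i ∉ S → χ i = 0) :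
    orbitMultiplicity ℂ (detFormLex ℂ 3) 3 χ = plethysmCoeff ℂ (MatIdx 3) 3 χ :=
  det_orbitMultiplicity_eq_plethysmCoeff_of_support_card_le_of_kForms
    quaternaryCubic_mem_orbitClosure_detFormLex S hS χ hχ

/-- **Row 4 of the few-row table at `m = 3`, determinant column: `K_3(λ*) = a_λ(δ[3])` for
`ℓ(λ) ≤ 4`** (`= plethysmCoeffOfPartition ℂ k 3 λ` for any `ℓ(λ) ≤ k ≤ 9`): the ideal of
`Δ(det_3)` contains no highest-weight vector of a type with at most four rows, in any degree.
[this crux] -/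
theorem det_three_orbitMultiplicity_eq_plethysmCoeffOfPartition_of_card_parts_le_four {k d : ℕ}
    (hk : k ≤ 3 * 3) (lam : Nat.Partition d) (h4 : lam.parts.card ≤ 4) (hlam : lam.parts.card ≤ k) :
    orbitMultiplicity ℂ (detFormLex ℂ 3) 3 (Weight.dualOfPartition (3 * 3) lam).toMatIdx =
      plethysmCoeffOfPartition ℂ k 3 lam :=
  det_orbitMultiplicity_eq_plethysmCoeffOfPartition_of_card_parts_le_of_kForms
    quaternaryCubic_mem_orbitClosure_detFormLex hk lam h4 hlam

/-- **No valuative flip on shapes with at most four rows at `m = 3`.** For every `n ≤ 3`, every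
centre `(U, r)` with ranks `≤ r` on `U`, every `δ` and every `λ ⊢ 3δ` with `ℓ(λ) ≤ 4`, the crux's
truncation `T_U(λ)` (verbatim body of `ValuativeGCT.ValuativeFlip`) satisfies
`mult_pp(λ*) ≤ dim T_U(λ)`. [this crux] -/
theorem noValuativeFlip_three_of_card_parts_le_four {n : ℕ} (hn : n ≤ 3)
    (U : Submodule ℂ (MatIdx 3 → ℂ)) (r : ℕ)
    (hU : ∀ u ∈ U, (Matrix.of fun a b : Fin 3 => u (toLex (a, b))).rank ≤ r)
    (δ : ℕ) (lam : Nat.Partition (3 * δ)) (h4 : lam.parts.card ≤ 4) :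
    let χ : Literature.NumberTheory.DiophantineGeometry.Weight (Literature.NumberTheory.DiophantineGeometry.MatIdx 3) := (Literature.NumberTheory.DiophantineGeometry.Weight.dualOfPartition (3 * 3) lam).toMatIdx; let T : Submodule ℂ (MvPolynomial (Literature.NumberTheory.DiophantineGeometry.MatIdx 3 × Literature.NumberTheory.DiophantineGeometry.MatIdx 3) ℂ) := MvPolynomial.homogeneousSubmodule (Literature.NumberTheory.DiophantineGeometry.MatIdx 3 × Literature.NumberTheory.DiophantineGeometry.MatIdx 3) ℂ (3 * δ) ⊓ ((MvPolynomial.vanishingIdeal ℂ {p : Literature.NumberTheory.DiophantineGeometry.MatIdx 3 × Literature.NumberTheory.DiophantineGeometry.MatIdx 3 → ℂ | ∀ j : Literature.NumberTheory.DiophantineGeometry.MatIdx 3, (fun i => p (j, i)) ∈ U}) ^ (δ * (3 - r))).restrictScalars ℂ ⊓ (⨅ (M : Matrix (Literature.NumberTheory.DiophantineGeometry.MatIdx 3) (Literature.NumberTheory.DiophantineGeometry.MatIdx 3) ℂ) (_ : Literature.Computability.AlgebraicComplexity.linSubst (Literature.NumberTheory.DiophantineGeometry.MatIdx 3) ℂ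 M (Literature.NumberTheory.DiophantineGeometry.detFormLex ℂ 3) = Literature.NumberTheory.DiophantineGeometry.detFormLex ℂ 3), LinearMap.ker ((MvPolynomial.aeval (R := ℂ) fun p : Literature.NumberTheory.DiophantineGeometry.MatIdx 3 × Literature.NumberTheory.DiophantineGeometry.MatIdx 3 => ∑ l : Literature.NumberTheory.DiophantineGeometry.MatIdx 3, M l p.2 • MvPolynomial.X (p.1, l)).toLinearMap - LinearMap.id (R := ℂ) (M := MvPolynomial (Literature.NumberTheory.DiophantineGeometry.MatIdx 3 × Literature.NumberTheory.DiophantineGeometry.MatIdx 3) ℂ))) ⊓ (⨅ (g : Matrix.GeneralLinearGroup (Literature.NumberTheory.DiophantineGeometry.MatIdx 3) ℂ) (_ : Literature.NumberTheory.DiophantineGeometry.IsUpperTriangular g), LinearMap.ker ((MvPolynomial.aeval (R := ℂ) fun p : Literature.NumberTheory.DiophantineGeometry.MatIdx 3 × Literature.NumberTheory.DiophantineGeometry.MatIdx 3 => ∑ l : Literature.NumberTheory.DiophantineGeometry.MatIdx 3, ((g⁻¹ : Matrix.GeneralLinearGroup (Literature.NumberTheory.DiophantineGeometry.MatIdx 3)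 ℂ) : Matrix (Literature.NumberTheory.DiophantineGeometry.MatIdx 3) (Literature.NumberTheory.DiophantineGeometry.MatIdx 3) ℂ) p.1 l • MvPolynomial.X (l, p.2)).toLinearMap - Literature.NumberTheory.DiophantineGeometry.weightChar χ g • LinearMap.id (R := ℂ) (M := MvPolynomial (Literature.NumberTheory.DiophantineGeometry.MatIdx 3 × Literature.NumberTheory.DiophantineGeometry.MatIdx 3) ℂ))); Literature.NumberTheory.DiophantineGeometry.orbitMultiplicity ℂ (Literature.NumberTheory.DiophantineGeometry.paddedPerFormLex ℂ n 3) 3 χ ≤ Module.finrank ℂ ↥T :=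
  noValuativeFlip_of_card_parts_le_of_kForms 3 hn 4 quaternaryCubic_mem_orbitClosure_detFormLex U r
    hU δ lam h4 (h4.trans (by norm_num))

/-- **Every valuative-flip witness at `m = 3` has at least five rows** — in particular the flips
at the bottom `(n, m) = (3, 3)` of the window (landed, `…BottomWindow`) live on shapes with `≥ 5`
rows. [this crux] -/
theorem five_le_card_parts_of_valuativeFlip_three {n : ℕ} (hn : n ≤ 3)
    (U : Submodule ℂ (MatIdx 3 → ℂ)) (r : ℕ)
    (hU : ∀ u ∈ U, (Matrix.of fun a b : Fin 3 => u (toLex (a, b))).rank ≤ r)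
    (δ : ℕ) (lam : Nat.Partition (3 * δ)) (hcard : lam.parts.card ≤ 3 * 3)
    (hflip : let χ : Literature.NumberTheory.DiophantineGeometry.Weight (Literature.NumberTheory.DiophantineGeometry.MatIdx 3) := (Literature.NumberTheory.DiophantineGeometry.Weight.dualOfPartition (3 * 3) lam).toMatIdx; let T : Submodule ℂ (MvPolynomial (Literature.NumberTheory.DiophantineGeometry.MatIdx 3 × Literature.NumberTheory.DiophantineGeometry.MatIdx 3) ℂ) := MvPolynomial.homogeneousSubmodule (Literature.NumberTheory.DiophantineGeometry.MatIdx 3 × Literature.NumberTheory.DiophantineGeometry.MatIdx 3) ℂ (3 * δ) ⊓ ((MvPolynomial.vanishingIdeal ℂ {p : Literature.NumberTheory.DiophantineGeometry.MatIdx 3 × Literature.NumberTheory.DiophantineGeometry.MatIdx 3 → ℂ | ∀ j : Literature.NumberTheory.DiophantineGeometry.MatIdx 3, (fun i => p (j, i)) ∈ U}) ^ (δ * (3 - r))).restrictScalars ℂ ⊓ (⨅ (M : Matrix (Literature.NumberTheory.DiophantineGeometry.MatIdx 3) (Literature.NumberTheory.DiophantineGeometry.MatIdx 3) ℂ) (_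 : Literature.Computability.AlgebraicComplexity.linSubst (Literature.NumberTheory.DiophantineGeometry.MatIdx 3) ℂ M (Literature.NumberTheory.DiophantineGeometry.detFormLex ℂ 3) = Literature.NumberTheory.DiophantineGeometry.detFormLex ℂ 3), LinearMap.ker ((MvPolynomial.aeval (R := ℂ) fun p : Literature.NumberTheory.DiophantineGeometry.MatIdx 3 × Literature.NumberTheory.DiophantineGeometry.MatIdx 3 => ∑ l : Literature.NumberTheory.DiophantineGeometry.MatIdx 3, M l p.2 • MvPolynomial.X (p.1, l)).toLinearMap - LinearMap.id (R := ℂ) (M := MvPolynomial (Literature.NumberTheory.DiophantineGeometry.MatIdx 3 × Literature.NumberTheory.DiophantineGeometry.MatIdx 3) ℂ))) ⊓ (⨅ (g : Matrix.GeneralLinearGroup (Literature.NumberTheory.DiophantineGeometry.MatIdx 3) ℂ) (_ : Literature.NumberTheory.DiophantineGeometry.IsUpperTriangular g), LinearMap.ker ((MvPolynomial.aeval (R := ℂ) fun p : Literature.NumberTheory.DiophantineGeometry.MatIdx 3 × Literature.NumberTheory.DiophantineGeometry.MatIdx 3 => ∑ l : Literature.NumberTheory.DiophantineGeometry.MatIdx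 3, ((g⁻¹ : Matrix.GeneralLinearGroup (Literature.NumberTheory.DiophantineGeometry.MatIdx 3) ℂ) : Matrix (Literature.NumberTheory.DiophantineGeometry.MatIdx 3) (Literature.NumberTheory.DiophantineGeometry.MatIdx 3) ℂ) p.1 l • MvPolynomial.X (l, p.2)).toLinearMap - Literature.NumberTheory.DiophantineGeometry.weightChar χ g • LinearMap.id (R := ℂ) (M := MvPolynomial (Literature.NumberTheory.DiophantineGeometry.MatIdx 3 × Literature.NumberTheory.DiophantineGeometry.MatIdx 3) ℂ))); Module.finrank ℂ ↥T < Literature.NumberTheory.DiophantineGeometry.orbitMultiplicity ℂ (Literature.NumberTheory.DiophantineGeometry.paddedPerFormLex ℂ n 3) 3 χ) :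
    5 ≤ lam.parts.card :=
  succ_le_card_parts_of_valuativeFlip_of_kForms 3 hn 4 quaternaryCubic_mem_orbitClosure_detFormLex
    U r hU δ lam hcard hflip

/-- **The few-row sandwich at `m = 3`, row 4: `mult_pp(λ*) ≤ K_3(λ*)`** for every `n ≤ 3` and every
`λ ⊢ 3δ` with `ℓ(λ) ≤ 4` — the multiplicity inequality of the Mulmuley–Sohoni programme fails on
four-row shapes at `m = 3`, at every padding. [this crux] -/
theorem orbitMultiplicity_paddedPer_le_det_three_of_card_parts_le_four {n : ℕ} (hn : n ≤ 3) {δ : ℕ}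
    (lam : Nat.Partition (3 * δ)) (h4 : lam.parts.card ≤ 4) :
    orbitMultiplicity ℂ (paddedPerFormLex ℂ n 3) 3 (Weight.dualOfPartition (3 * 3) lam).toMatIdx ≤
      orbitMultiplicity ℂ (detFormLex ℂ 3) 3 (Weight.dualOfPartition (3 * 3) lam).toMatIdx := by
  refine orbitMultiplicity_paddedPer_le_det_of_topForms_mem_orbitClosure hn 4
    (topForms_mem_orbitClosure_detFormLex_of_kForms quaternaryCubic_mem_orbitClosure_detFormLex) _
    fun i hi => ?_
  obtain ⟨i', rfl⟩ : ∃ i' : Fin (3 * 3), matIdxEquiv 3 i' = i :=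
    ⟨(matIdxEquiv 3).symm i, (matIdxEquiv 3).apply_symm_apply i⟩
  refine NoValuativeFlip.dualOfPartition_toMatIdx_eq_zero_of_lt lam i' ?_
  simp only [OrderIso.symm_apply_apply] at hi
  omega

end Cubics

/-! ## `m = 2`: `Det_2 = Sym² ℂ⁴` has no equations at all -/

section Quadrics

/-- **Every quadratic form on the four letters of `MatIdx 2` lies in `Δ(det_2)`**, i.e.
`Δ(det_2) = Sym² ℂ⁴`: the pencil density criterion at `quaternaryQuadricPencil_certificate`
(classically: every quadric in four variables has rank `≤ 4` and is `ℓ₁ℓ₄ - ℓ₂ℓ₃`). [this crux] -/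
theorem quadric_mem_orbitClosure_detFormLex_two (q : MvPolynomial (MatIdx 2) ℂ)
    (hq : q.IsHomogeneous 2) : q ∈ orbitClosure (detFormLex ℂ 2) := by
  refine topForms_mem_orbitClosure_detFormLex_of_certificate 2 A₄₂
    quaternaryQuadricPencil_certificate q hq fun i _ => ?_
  have := ((matIdxEquiv 2).symm i).2
  omega

/-- **The ideal of `Δ(det_2)` is zero**: no nonzero polynomial in the ten coefficients of a
quaternary quadric vanishes on `GL_4 · det_2`. [this crux] -/
theorem orbitVanishingIdeal_detFormLex_two_eq_bot : orbitVanishingIdeal (detFormLex ℂ 2) 2 = ⊥ :=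
  orbitVanishingIdeal_detFormLex_eq_bot_of_allForms quadric_mem_orbitClosure_detFormLex_two

/-- **`K_2(χ) = pleth(χ)` for every weight `χ` of `GL_4`**: the coordinate ring of `Δ(det_2)` is
all of `ℂ[Sym² ℂ⁴]`. [this crux] -/
theorem det_two_orbitMultiplicity_eq_plethysmCoeff (χ : Weight (MatIdx 2)) :
    orbitMultiplicity ℂ (detFormLex ℂ 2) 2 χ = plethysmCoeff ℂ (MatIdx 2) 2 χ :=
  det_orbitMultiplicity_eq_plethysmCoeff_of_allForms quadric_mem_orbitClosure_detFormLex_two χ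

/-- **`Det_2` majorises every orbit closure of a quadric on `MatIdx 2`**: `mult_χ ℂ[Δ_2(g)] ≤ K_2(χ)`
for every quadratic form `g` and every weight `χ`. [this crux] -/
theorem orbitMultiplicity_le_det_two {g : MvPolynomial (MatIdx 2) ℂ} (hg : g.IsHomogeneous 2)
    (χ : Weight (MatIdx 2)) : orbitMultiplicity ℂ g 2 χ ≤ orbitMultiplicity ℂ (detFormLex ℂ 2) 2 χ := by
  classical
  exact orbitMultiplicity_le_det_of_support_card_le_of_kForms (k := 2 * 2)
    (fun _ q hq _ => quadric_mem_orbitClosure_detFormLex_two q hq) hg Finset.univ (by simp) χ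
    fun i hi => absurd (Finset.mem_univ i) hi

/-- **No valuative flip at `m = 2`, for any shape.** For every `n ≤ 2`, every centre `(U, r)`,
every `δ` and every `λ ⊢ 2δ` with `ℓ(λ) ≤ 4`: `mult_pp(λ*) ≤ dim T_U(λ)` (crux body verbatim).
[this crux] -/
theorem noValuativeFlip_two {n : ℕ} (hn : n ≤ 2)
    (U : Submodule ℂ (MatIdx 2 → ℂ)) (r : ℕ)
    (hU : ∀ u ∈ U, (Matrix.of fun a b : Fin 2 => u (toLex (a, b))).rank ≤ r)
    (δ : ℕ) (lam : Nat.Partition (2 * δ)) (hcard : lam.parts.card ≤ 2 * 2) :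
    let χ : Literature.NumberTheory.DiophantineGeometry.Weight (Literature.NumberTheory.DiophantineGeometry.MatIdx 2) := (Literature.NumberTheory.DiophantineGeometry.Weight.dualOfPartition (2 * 2) lam).toMatIdx; let T : Submodule ℂ (MvPolynomial (Literature.NumberTheory.DiophantineGeometry.MatIdx 2 × Literature.NumberTheory.DiophantineGeometry.MatIdx 2) ℂ) := MvPolynomial.homogeneousSubmodule (Literature.NumberTheory.DiophantineGeometry.MatIdx 2 × Literature.NumberTheory.DiophantineGeometry.MatIdx 2) ℂ (2 * δ) ⊓ ((MvPolynomial.vanishingIdeal ℂ {p : Literature.NumberTheory.DiophantineGeometry.MatIdx 2 × Literature.NumberTheory.DiophantineGeometry.MatIdx 2 → ℂ | ∀ j : Literature.NumberTheory.DiophantineGeometry.MatIdx 2, (fun i => p (j, i)) ∈ U}) ^ (δ * (2 - r))).restrictScalars ℂ ⊓ (⨅ (M : Matrix (Literature.NumberTheory.DiophantineGeometry.MatIdx 2) (Literature.NumberTheory.DiophantineGeometry.MatIdx 2) ℂ) (_ : Literature.Computability.AlgebraicComplexity.linSubst (Literature.NumberTheory.DiophantineGeometry.MatIdx 2) ℂ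 M (Literature.NumberTheory.DiophantineGeometry.detFormLex ℂ 2) = Literature.NumberTheory.DiophantineGeometry.detFormLex ℂ 2), LinearMap.ker ((MvPolynomial.aeval (R := ℂ) fun p : Literature.NumberTheory.DiophantineGeometry.MatIdx 2 × Literature.NumberTheory.DiophantineGeometry.MatIdx 2 => ∑ l : Literature.NumberTheory.DiophantineGeometry.MatIdx 2, M l p.2 • MvPolynomial.X (p.1, l)).toLinearMap - LinearMap.id (R := ℂ) (M := MvPolynomial (Literature.NumberTheory.DiophantineGeometry.MatIdx 2 × Literature.NumberTheory.DiophantineGeometry.MatIdx 2) ℂ))) ⊓ (⨅ (g : Matrix.GeneralLinearGroup (Literature.NumberTheory.DiophantineGeometry.MatIdx 2) ℂ) (_ : Literature.NumberTheory.DiophantineGeometry.IsUpperTriangular g), LinearMap.ker ((MvPolynomial.aeval (R := ℂ) fun p : Literature.NumberTheory.DiophantineGeometry.MatIdx 2 × Literature.NumberTheory.DiophantineGeometry.MatIdx 2 => ∑ l : Literature.NumberTheory.DiophantineGeometry.MatIdx 2, ((g⁻¹ : Matrix.GeneralLinearGroup (Literature.NumberTheory.DiophantineGeometry.MatIdx 2)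 ℂ) : Matrix (Literature.NumberTheory.DiophantineGeometry.MatIdx 2) (Literature.NumberTheory.DiophantineGeometry.MatIdx 2) ℂ) p.1 l • MvPolynomial.X (l, p.2)).toLinearMap - Literature.NumberTheory.DiophantineGeometry.weightChar χ g • LinearMap.id (R := ℂ) (M := MvPolynomial (Literature.NumberTheory.DiophantineGeometry.MatIdx 2 × Literature.NumberTheory.DiophantineGeometry.MatIdx 2) ℂ))); Literature.NumberTheory.DiophantineGeometry.orbitMultiplicity ℂ (Literature.NumberTheory.DiophantineGeometry.paddedPerFormLex ℂ n 2) 2 χ ≤ Module.finrank ℂ ↥T :=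
  noValuativeFlip_of_card_parts_le_of_kForms 2 hn (2 * 2)
    (fun _ q hq _ => quadric_mem_orbitClosure_detFormLex_two q hq) U r hU δ lam hcard hcard

end Quadrics

end

end Summit.ValiantsHypothesis.ValiantsHypothesis.Theorems.ValuativeFlip
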